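import Summits.BirchSwinnertonDyer.Rank1Residual.Supersingular.KobayashiSqueezeReal
import Summits.BirchSwinnertonDyer.Rank1Residual.Supersingular.SignedRankOneCorA5
import Summits.BirchSwinnertonDyer.Rank1Residual.X1.LambdaSqueezeAlgebra
import Summits.BirchSwinnertonDyer.Rank1Residual.X1.MuPart
import Literature.NumberTheory.EllipticCurves.BDKim2009.SignedSelmerCongruentLambdaInvariant
import HarnessLib

/-!
# Route `SignedLowerHalves`, crux `KobayashiLowerHalfLargeImage` (item stmt-BirchSwinnertonDyer-19001):
# the CONGRUENCE ROAD to Kobayashi's signed main conjecture AT A PAIR of any `λ` — Kato's divisibility,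
# the pair's own Mazur–Tate certificate `(μ, λ)(L^ε_p) = (0, l)`, and the `λ`-invariant of `X^ε`
# TRANSFERRED from a `p`-congruent partner by B. D. Kim 2009 (cell `bsd-ssimc`, seat `bsd-ssimc-k3-c3`
# gen 6; a `--supports stmt-BirchSwinnertonDyer-19001 --as helper` file; closes nothing)

PARTITION (cell bsd-ssimc): X7 (A7) × item 3's rank-ONE window OFF the tight Mazur–Tate rows (cells
with `λ(L^ε_p) ≥ 3`, where the rank-one squeeze `kobayashiMainConjecture_of_lam_eq_one_of_analyticRank_eq_one`
is void) — closes PER PAIR only; types-the-object-of the crux's conclusion at such pairs; the crux stays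
OPEN; nothing booked; BSD is not proved by any of this. THEOREMS ONLY: no definition, no new named fact
here (the one fact consumed beyond the squeeze's, B. D. Kim 2009 Cor. 2.13 (2nd claim) ∘ Cor. 2.5 ∘
Prop. 2.6, is `BDKim2009.cor213_signedLambda_add_sum_delta_eq_of_torsionIso`, p461917).

## The road (Greenberg–Vatsal at a supersingular prime, WITHOUT an analytic transfer theorem)

Fix `E = W` (globally minimal), `p` odd good with `a_p = 0`, `ρ̄_{E,p}` onto, a sign `ε`. For every
datum `(κ, γ, f, ϖ, (L⁺,L⁻), D)` of `KobayashiMainConjecture W p ε`, with `ξ` a generator of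
`char X^ε` (principal) and `L = L^ε_p` (Kobayashi's labelling):
1. Kato–Kobayashi (Thm. 4.1, `h41`, integral under `p`-adic surjectivity ⇐ mod-`p` surjectivity,
   Serre / Wuthrich Lemma 20 `hL20`): `ξ ∣ L`, say `L = ξ·h`;
2. the pair's OWN two-engine certificate (`hcert`, read off ONE Mazur–Tate element by the tree's
   `lam_signed_neg_one/one_eq_of_mazurTate`): `μ(L) = 0`, `λ(L) = l`; hence `μ(ξ) = 0`, i.e.
   `μ(X^ε) = 0` (`Summit.BirchSwinnertonDyer.Rank1Residual.X1.MuPart.mu_generator_eq_muInvariant`) — Kim's "assuming either" is met on `E`'s side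
   from Kato's divisibility alone;
3. a CONGRUENT PARTNER `E′ = W′` (`E′[p] ≅ E[p]` as `Γ_ℚ`-modules, good at `p` with `a_p(E′) = 0`)
   whose `λ(X^ε(E′/ℚ_∞)) = l′` is KNOWN (§2: `l′ = 0` in the unit zone `ord_p L(E′,1)/Ω_{E′} = 0`;
   §3: `l′ = 1` at a rank-one pair with a tight certificate), and B. D. Kim 2009 Cor. 2.13 + Cor. 2.5
   + Prop. 2.6 (`hKim`): `λ(X^ε(E)) + Σ_{ℓ∈Σ₀} δ_E^{(ℓ)} = l′ + Σ_{ℓ∈Σ₀} δ_{E′}^{(ℓ)}` with the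
   Greenberg–Vatsal local terms `δ = s_ℓ d_ℓ` (`GreenbergVatsal2000.delta`), `Σ₀ ⊇` bad primes of both;
4. the per-pair DECIDABLE bookkeeping `hδ : l + Σ δ_E = l′ + Σ δ_{E′}` gives `λ(ξ) = λ(X^ε) = l = λ(L)`
   (`Summit.BirchSwinnertonDyer.Rank1Residual.X1.ParitySqueeze.lam_generator_eq_lambdaInvariant`), and with `μ(L) = 0 ≤ μ(ξ)` the cofactor `h` is a
   unit (`span_eq_span_iff_mu_le_and_lam_le`): `(ξ) = (L)`; finally `ϖ ∈ ℤ_p^×` (period-unit facts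
   `h5`/`h3`) exactly as in the squeeze. Hence `KobayashiMainConjecture W p ε` (§1), the crux's
   conclusion `∃ ε, KobayashiLowerDivisibility W p ε` at the pair and, in analytic rank one, `BSD(E,p)`
   via Burungale–Kobayashi–Ota Cor. A.5 (§4).
No analytic congruence is used (the signed ANALYTIC transfer is preprint-only: Corpuz–Lei
arXiv:2508.09733 Thm 1, Kim–Lee–Ponsinet arXiv:1909.01764 — NOT used), no CM partner, no preprint.
SIGN DICTIONARY (planner D22-3 C2; ONE convention, the tree's): `ε : ℤˣ` is Kobayashi's sign of
`Sel^ε` throughout (`SignedSelmerDualData W κ γ ε`, `kobayashiL ε`, `IsSignedPAdicLFunction f p ε`,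
tied by `IsPollackPair.isSignedPAdicLFunction_kobayashiL`); a Mazur–Tate row with `odd := true` (odd
layer `n`) certifies `(μ, λ)` of the `ε = −1` function (tree `L⁺ = L♯`; `lam_signed_neg_one_eq_of_mazurTate'`),
a row with `odd := false` (even `n`) that of `ε = 1` (`L⁻ = L♭`; `lam_signed_one_eq_of_mazurTate'`) —
exactly as in `MazurTateRecordsX7Three.lean` and the MT-road records; `hcert` and `hlam′` carry the SAME `ε`.
CENSUS (this seat, 2026-08-26, memo k3-c3 MEMO-7): of the 45 X7 ∧ surj ∧ r_an = 1 pairs with a NON-tight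
two-engine row in `MazurTateRecordsX7Three/X7Large`, three have a certified partner in Cremona's range
(16112g1 @ 3 and 19040i1 @ 3 with λ± = 3, unit partners; the engine-free-core pair 16456g1 @ 3 with
λ± = 5, tight rank-one partner 294712c1), and in all 17 partner pairs step 4 predicts EXACTLY the
certified λ. Records are separate files.

References: [Kobayashi2003] Conj. (p. 2), Thm. 1.2, 4.1, (3.6); [BDKim2009] Cor. 2.13, 2.5, Prop. 2.6;
[GreenbergVatsal2000] Prop. (2.4), p. 4; [Pollack2003] 6.9/6.10/6.18; [Wuthrich2014] L. 20; [BurungaleKobayashiOta2023] Cor. A.5.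
-/

set_option autoImplicit false
set_option linter.dupNamespace false
noncomputable section

open scoped Classical MatrixGroups ModularForm BigOperators

open CongruenceSubgroup WeierstrassCurve NumberField IsDedekindDomain
  Literature.NumberTheory.EllipticCurves
  Literature.NumberTheory.EllipticCurves.ModularForms
  Literature.NumberTheory.EllipticCurves.Rank1Residual
  Literature.NumberTheory.EllipticCurves.Rank1Residual.Typed
  Literature.NumberTheory.EllipticCurves.Kobayashi2003 ZpExtension
  Literature.NumberTheory.EllipticCurves.BurungaleKobayashiOta2024
  Literature.NumberTheory.EllipticCurves.GreenbergVatsal2000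
  Summit.BirchSwinnertonDyer.Rank1Residual.X1.MuLambda
  Summit.BirchSwinnertonDyer.Rank1Residual.Supersingular

namespace Summit.BirchSwinnertonDyer.BirchSwinnertonDyer.Theorems.CongruenceRoad

variable {W : WeierstrassCurve ℚ} [W.IsElliptic] [W.IsGloballyMinimal] {p : ℕ} [Fact p.Prime]

/-! ### §1 The road: Kobayashi's main conjecture at a pair from Kato, the pair's certificate and a transferred `λ` -/

/-- **Kobayashi's main conjecture for `(E, p, ε)` AT THE PAIR from the congruence road.** Inputs BY
NAME: Kobayashi Thm. 1.2 (`h12`) and Thm. 4.1 (`h41`, Kato-side, integral under surjectivity via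
`hL20`), the period-unit facts (`h5`, `h3`), B. D. Kim 2009 Cor. 2.13 (second claim, `hKim`); per-pair
DATA: `p` odd good, `a_p = 0`, `ρ̄_{E,p}` onto, the two-engine certificate `hcert : (μ, λ)(L^ε_p(E)) = (0, l)`,
a partner `W′` good at `p` with `a_p = 0` and `W[p] ≃ W′[p]` (`he`), its transferred datum
`hλ′ : λ(X^ε(W′/ℚ_∞)) = l′` (for every Pontryagin-dual datum), a finite set `S₀` of places away from `p`
containing the bad places of both curves, and the identity `hδ : l + Σ_{S₀} δ_W = l′ + Σ_{S₀} δ_{W′}`.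
Conclusion: `KobayashiMainConjecture W p ε` VERBATIM. PER PAIR; NOT a class theorem; closes nothing.
[cite: Kobayashi2003, Thm. 1.2, Thm. 4.1 (p. 8) and Conjecture (p. 2)] [cite: BDKim2009, Cor. 2.13, Cor. 2.5 and Prop. 2.6 (pp. 185–187)]
[cite: GreenbergVatsal2000, p. 4 and §2 Prop. (2.4)] [cite: Wuthrich2014, Lemma 20 (p. 399)] -/
theorem kobayashiMainConjecture_of_lambdaTransfer
    (h12 : Kobayashi2003.thm12_signedSelmerDual_finite_torsion)
    (h41 : Kobayashi2003.thm41_signedCharIdeal_divisibility)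
    (h5 : realPeriodRat_eq_unit_mul_plusPeriod) (h3 : realPeriodRat_eq_unit_mul_plusPeriod_three)
    (hL20 : Wuthrich2014.lemma20_surjective_threeAdic_of_semistable)
    (hKim : BDKim2009.cor213_signedLambda_add_sum_delta_eq_of_torsionIso)
    (hp : p ≠ 2) (hgood : W.HasGoodReductionAtPrime p) (hap : W.frobeniusTrace p = 0)
    (hs : Surj W p) (ε : ℤˣ) {l : ℕ}
    (hcert : ∀ {N : ℕ} [NeZero N] (f : CuspForm (Gamma0 N) 2), IsNewformOf W f →
      ∀ L : IwasawaAlgebra p, IsSignedPAdicLFunction f p ε L → mu L = 0 ∧ lam L = l)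
    {W' : WeierstrassCurve ℚ} [W'.IsElliptic] [W'.IsGloballyMinimal]
    (hgood' : W'.HasGoodReductionAtPrime p) (hap' : W'.frobeniusTrace p = 0)
    (he : ∃ e : geomTorsion W (p : ℤ) ≃+ geomTorsion W' (p : ℤ),
      ∀ (σ : Field.absoluteGaloisGroup ℚ) (P : geomTorsion W (p : ℤ)), e (σ • P) = σ • e P)
    {l' : ℕ}
    (hlam' : ∀ (κ : ZpExtension ℚ p) (γ : Field.absoluteGaloisGroup ℚ), κ.IsCyclotomic →
      κ.IsTopGenerator γ → IsCyclotomicVariable p γ → ∀ (D' : SignedSelmerDualData W' κ γ ε)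
      [Module.Finite (IwasawaAlgebra p) D'.X], Module.IsTorsion (IwasawaAlgebra p) D'.X →
      lambdaInvariant p D'.X = l')
    (S₀ : Finset (HeightOneSpectrum (𝓞 ℚ))) (hS₀ : ∀ v ∈ S₀, ((p : ℕ) : 𝓞 ℚ) ∉ v.asIdeal)
    (hS₀W : ∀ v : HeightOneSpectrum (𝓞 ℚ), ¬ W.HasGoodReductionAt v → v ∈ S₀)
    (hS₀W' : ∀ v : HeightOneSpectrum (𝓞 ℚ), ¬ W'.HasGoodReductionAt v → v ∈ S₀)
    (hδ : l + ∑ v ∈ S₀, delta W p v = l' + ∑ v ∈ S₀, delta W' p v) :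
    KobayashiMainConjecture W p ε := by
  intro κ γ hκ hγ hγ' _ f hf ϖ hϖ Lplus Lminus hPP D
  -- Thm. 1.2: `X^ε` finitely generated and torsion
  haveI : Module.Finite (IwasawaAlgebra p) D.X := h12.moduleFinite hp hgood hap hκ hγ D
  have hX : Module.IsTorsion (IwasawaAlgebra p) D.X := h12.isTorsion hp hgood hap hκ hγ D
  refine ⟨hX, ?_⟩
  -- a generator `ξ` of `Char(X^ε)`
  obtain ⟨ξ, hξ⟩ := (charIdeal_isPrincipal_holds p D.X).principal
  have hξ' : D.charIdeal = Ideal.span {ξ} := hξ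
  -- Kobayashi's `L_p^ε` out of the Pollack pair; Kato: `ξ ∣ L`
  set L := kobayashiL ε Lplus Lminus with hL_def
  have hL : IsSignedPAdicLFunction f p ε L := hPP.isSignedPAdicLFunction_kobayashiL ε
  have hsurj : ∀ m : ℕ, W.HasSurjectiveModNGaloisRep (p ^ m : ℕ) :=
    surjective_pow_of_surj_of_good W p hL20 hp hgood hs
  have hU : ξ ∣ L := h41.dvd_of_charIdeal_eq_span hp hgood hap hf hκ hγ hγ' hL D hX hsurj hξ'
  -- the pair's certificate
  obtain ⟨hμL, hlamL⟩ := hcert f hf L hL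
  have hL0 : L ≠ 0 := by
    rw [hL_def]
    unfold kobayashiL
    split_ifs
    · exact hPP.2.1
    · exact hPP.1
  obtain ⟨h, hfac⟩ := hU
  have hξ0 : ξ ≠ 0 := by
    rintro rfl
    exact hL0 (by rw [hfac, zero_mul])
  have hh0 : h ≠ 0 := by
    rintro rfl
    exact hL0 (by rw [hfac, mul_zero])
  -- `μ(ξ) = 0`, i.e. `μ(X^ε) = 0` — Kim's "assuming either" on `E`'s side, from Kato's divisibility
  have hμξ : mu ξ = 0 := by
    have hle := mu_le_mu_mul hξ0 hh0
    rw [← hfac, hμL] at hle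
    omega
  have hDmu : D.mu = 0 := by
    show muInvariant p D.X = 0
    rw [← Summit.BirchSwinnertonDyer.Rank1Residual.X1.MuPart.mu_generator_eq_muInvariant D.X hX hξ0 hξ]
    exact hμξ
  -- the partner's datum and Kim's transfer
  obtain ⟨D'⟩ := nonempty_signedSelmerDualData W' κ ε hγ
  haveI : Module.Finite (IwasawaAlgebra p) D'.X := h12.moduleFinite hp hgood' hap' hκ hγ D'
  have hX' : Module.IsTorsion (IwasawaAlgebra p) D'.X := h12.isTorsion hp hgood' hap' hκ hγ D'
  have hlamD' : lambdaInvariant p D'.X = l' := hlam' κ γ hκ hγ hγ' D' hX'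
  have hT := hKim W W' p hp hgood hap hgood' hap' he κ γ hκ hγ S₀ hS₀ hS₀W hS₀W' ε D D' hX hX' hDmu
  have hlamD : lambdaInvariant p D.X = l := by
    rw [hlamD'] at hT
    omega
  have hlamξ : lam ξ = l := by
    rw [Summit.BirchSwinnertonDyer.Rank1Residual.X1.ParitySqueeze.lam_generator_eq_lambdaInvariant D.X hX hξ0 hξ, hlamD]
  -- the squeeze: `(ξ) = (L)`
  have hspan : Ideal.span ({ξ} : Set (IwasawaAlgebra p)) = Ideal.span {L} :=
    ((span_eq_span_iff_mu_le_and_lam_le hξ0 hL0 hfac).mpr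
      ⟨by rw [hμL]; exact Nat.zero_le _, by rw [hlamL, hlamξ]⟩).symm
  -- the period ratio `ϖ` is a `p`-adic unit (`E[p]` irreducible at a supersingular odd `p`)
  have hirr : W.HasIrreducibleModPGaloisRep p :=
    hasIrreducibleModPGaloisRep_of_dvd_frobeniusTrace W p hp
      (W.not_dvd_minimalDiscriminantInt_of_hasGoodReductionAtPrime' p hgood) (by rw [hap]; exact dvd_zero _)
  have hvϖ : padicValRat p ϖ = 0 := padicValRat_periodRatio_eq_zero h5 h3 W p hp hgood hirr f hf ϖ hϖ
  have hϖ0 : ϖ ≠ 0 := by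
    intro h0
    rw [h0, Rat.cast_zero, zero_mul] at hϖ
    exact (IsNewform0.plusPeriod_pos_holds hf.1 hf.coeffField_eq_bot).ne' hϖ.symm
  obtain ⟨u, hu⟩ := exists_units_coe_eq_ratCast hϖ0 hvϖ
  obtain ⟨hspan', hι⟩ := span_C_units_mul_eq u L
  refine ⟨PowerSeries.C (u : ℤ_[p]) * L, ?_, ?_⟩
  · rw [hξ', hspan, hspan']
  · rw [hι, hu]

/-! ### §2 The partner's datum in the UNIT ZONE: `ord_p L(E′,1)/Ω_{E′} = 0 ⇒ λ(X^ε(E′/ℚ_∞)) = 0` -/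

/-- **Unit-zone partner.** For `E′ = W′` with `p` odd good, `a_p = 0`, `ρ̄_{E′,p}` onto and
`L(E′,1)/Ω_{E′} = t ≠ 0` rational with `ord_p t = 0`: for every admissible `(κ, γ)` and every dual datum
`D′` of `Sel^ε(E′/ℚ_∞)` (f.g. torsion), `λ(D′.X) = 0`. Inputs BY NAME: `h41` (Kato `ξ′ ∣ L′`),
`h5`/`h3`, Pollack's pair (`hPollack`), modularity (`hmod`), `hL20`. Proof: Kobayashi (3.6) (PROVED,
`IsPollackPair.constantCoeff_kobayashiL`) makes `L′^ε(0) = c_ε·[0]⁺_{f′}` a `p`-adic unit, so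
`L′^ε ∈ Λ^×`, `ξ′ ∈ Λ^×`, `λ(X^ε(E′)) = λ(ξ′) = 0`. PER PAIR. [cite: Kobayashi2003, (3.6) (p. 7) and Thm. 4.1 (p. 8)]
[cite: GreenbergVatsal2000, §3 Remark 3.4] [cite: Wuthrich2014, Lemma 20 (p. 399)] -/
theorem lambdaInvariant_eq_zero_of_padicValRat_lRatio_eq_zero
    (h41 : Kobayashi2003.thm41_signedCharIdeal_divisibility)
    (h5 : realPeriodRat_eq_unit_mul_plusPeriod) (h3 : realPeriodRat_eq_unit_mul_plusPeriod_three)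
    (hL20 : Wuthrich2014.lemma20_surjective_threeAdic_of_semistable)
    {W' : WeierstrassCurve ℚ} [W'.IsElliptic] [W'.IsGloballyMinimal]
    (hPollack : ∀ {N : ℕ} [NeZero N] {f : CuspForm (Gamma0 N) 2},
      pollack_exists_plusMinusPAdicLFunction (W := W') (f := f) (p := p))
    (hmod : nonempty_modularParametrizationData)
    (hp : p ≠ 2) (hgood' : W'.HasGoodReductionAtPrime p) (hap' : W'.frobeniusTrace p = 0)
    (hs' : Surj W' p) {t : ℚ}
    (ht : W'.entireLFunction 1 / (W'.realPeriodRat : ℂ) = ((t : ℚ) : ℂ)) (ht0 : t ≠ 0)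
    (hv : padicValRat p t = 0) (ε : ℤˣ) :
    ∀ (κ : ZpExtension ℚ p) (γ : Field.absoluteGaloisGroup ℚ), κ.IsCyclotomic →
      κ.IsTopGenerator γ → IsCyclotomicVariable p γ → ∀ (D' : SignedSelmerDualData W' κ γ ε)
      [Module.Finite (IwasawaAlgebra p) D'.X], Module.IsTorsion (IwasawaAlgebra p) D'.X →
      lambdaInvariant p D'.X = 0 := by
  intro κ γ hκ hγ hγ' D' _ hX'
  -- modularity: the newform `f` of `E′` and its period ratio `ϖ`
  haveI : NeZero (W'.conductorNorm ℤ) := ⟨(W'.conductorNorm_pos_holds).ne'⟩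
  obtain ⟨Dm⟩ := hmod W'
  set f := Dm.f with hf_def
  have hf : IsNewformOf W' f := Dm.isNewformOf
  obtain ⟨ϖ, hϖpos, hϖ, hΩpos⟩ := Dm.exists_rat_mul_realPeriodRat_eq_plusPeriod
  -- a Pollack pair and Kobayashi's `L′^ε`
  obtain ⟨Lplus, Lminus, hPP⟩ := exists_isPollackPair hPollack hp hf hgood' hap'
  set L := kobayashiL ε Lplus Lminus with hL_def
  have hL : IsSignedPAdicLFunction f p ε L := hPP.isSignedPAdicLFunction_kobayashiL ε
  -- `t = ϖ · [0]⁺_f`, `ord_p ϖ = 0`, hence `ord_p [0]⁺_f = 0`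
  set s : ℚ := ratPlusSymbol f 0 with hs_def
  have hLval : W'.entireLFunction 1 = (((s : ℝ) * plusPeriod f : ℝ) : ℂ) := hf.entireLFunction_one_eq
  have hts : ((t : ℚ) : ℂ) = (((ϖ * s : ℚ)) : ℂ) := by
    rw [← ht, hLval, ← hϖ, div_eq_iff (Complex.ofReal_ne_zero.mpr hΩpos.ne')]
    push_cast
    ring
  have htϖs : t = ϖ * s := by exact_mod_cast hts
  have hϖ0 : ϖ ≠ 0 := hϖpos.ne'
  have hs0 : s ≠ 0 := by
    intro h0
    rw [h0, mul_zero] at htϖs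
    exact ht0 htϖs
  have hirr : W'.HasIrreducibleModPGaloisRep p :=
    hasIrreducibleModPGaloisRep_of_dvd_frobeniusTrace W' p hp
      (W'.not_dvd_minimalDiscriminantInt_of_hasGoodReductionAtPrime' p hgood') (by rw [hap']; exact dvd_zero _)
  have hvϖ : padicValRat p ϖ = 0 := padicValRat_periodRatio_eq_zero h5 h3 W' p hp hgood' hirr f hf ϖ hϖ
  have hvs : padicValRat p s = 0 := by
    have h1 : padicValRat p t = padicValRat p ϖ + padicValRat p s := by
      rw [htϖs, padicValRat.mul hϖ0 hs0]
    rw [hv, hvϖ, zero_add] at h1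
    exact h1.symm
  -- (3.6): `L(0) = c_ε · s` is a `p`-adic unit, so `L ∈ Λ^×`
  have hLε := hPP.constantCoeff_kobayashiL hp hf hgood' hap' ε
  have hcne : kobayashiConst p ε ≠ 0 := fun hz ↦
    not_dvd_kobayashiConst hp ε (by rw [hz]; exact dvd_zero p)
  have hc0 : (kobayashiConst p ε : ℚ_[p]) ≠ 0 := by exact_mod_cast hcne
  have hsQ0 : ((s : ℚ) : ℚ_[p]) ≠ 0 := by exact_mod_cast hs0
  have hL0ne : ((PowerSeries.constantCoeff L : ℤ_[p]) : ℚ_[p]) ≠ 0 := by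
    rw [hLε]; exact mul_ne_zero hc0 hsQ0
  have hvL : (((PowerSeries.constantCoeff L : ℤ_[p]) : ℚ_[p])).valuation = 0 := by
    rw [hLε, Padic.valuation_mul hc0 hsQ0, Padic.valuation_natCast,
      padicValNat.eq_zero_of_not_dvd (not_dvd_kobayashiConst hp ε), Padic.valuation_ratCast, hvs]
    simp
  have hLu : IsUnit L := by
    refine PowerSeries.isUnit_iff_constantCoeff.mpr (PadicInt.isUnit_iff.mpr ?_)
    rw [← PadicInt.padic_norm_e_of_padicInt, Padic.norm_eq_zpow_neg_valuation hL0ne, hvL,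
      neg_zero, zpow_zero]
  -- Kato: `ξ′ ∣ L′`, so `ξ′` is a unit and `λ(X^ε(E′)) = λ(ξ′) = 0`
  obtain ⟨ξ, hξ⟩ := (charIdeal_isPrincipal_holds p D'.X).principal
  have hξ' : D'.charIdeal = Ideal.span {ξ} := hξ
  have hsurj : ∀ m : ℕ, W'.HasSurjectiveModNGaloisRep (p ^ m : ℕ) :=
    surjective_pow_of_surj_of_good W' p hL20 hp hgood' hs'
  have hU : ξ ∣ L := h41.dvd_of_charIdeal_eq_span hp hgood' hap' hf hκ hγ hγ' hL D' hX' hsurj hξ'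
  have hξu : IsUnit ξ := isUnit_of_dvd_unit hU hLu
  rw [← Summit.BirchSwinnertonDyer.Rank1Residual.X1.ParitySqueeze.lam_generator_eq_lambdaInvariant D'.X hX' hξu.ne_zero hξ]
  exact ((isUnit_iff_mu_eq_zero_and_lam_eq_zero ξ).mp hξu).2.2

/-! ### §3 The partner's datum at a TIGHT rank-one pair: `(μ, λ)(L′^ε) = (0, 1) ⇒ λ(X^ε(E′/ℚ_∞)) = 1` -/

/-- **Tight rank-one partner.** For `E′ = W′` with `p` odd good, `a_p = 0`, `ρ̄_{E′,p}` onto,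
`r_an(E′) = 1` and the two-engine certificate `(μ, λ)(L′^ε_p) = (0, 1)` (`hcert′`): for every admissible
`(κ, γ)` and every dual datum `D′` of `Sel^ε(E′/ℚ_∞)`, `λ(D′.X) = 1` — Kato `ξ′ ∣ L′` (`h41`) bounds
`λ(ξ′) ≤ 1`, the control divisibility `T ∣ ξ′` ((C), tree theorem, + GZK `hGZK`) bounds it below.
PER PAIR. [cite: Kobayashi2003, Thm. 4.1 (p. 8)] [cite: GreenbergVatsal2000, p. 4] [cite: Wuthrich2014, Lemma 20 (p. 399)] -/
theorem lambdaInvariant_eq_one_of_lam_eq_one_of_analyticRank_eq_one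
    (h41 : Kobayashi2003.thm41_signedCharIdeal_divisibility)
    (hL20 : Wuthrich2014.lemma20_surjective_threeAdic_of_semistable)
    (hGZK : rank_eq_analyticRank_of_analyticRank_le_one)
    {W' : WeierstrassCurve ℚ} [W'.IsElliptic] [W'.IsGloballyMinimal]
    (hPollack : ∀ {N : ℕ} [NeZero N] {f : CuspForm (Gamma0 N) 2},
      pollack_exists_plusMinusPAdicLFunction (W := W') (f := f) (p := p))
    (hmod : nonempty_modularParametrizationData)
    (hp : p ≠ 2) (hgood' : W'.HasGoodReductionAtPrime p) (hap' : W'.frobeniusTrace p = 0)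
    (hs' : Surj W' p) (h1 : W'.analyticRank = 1) (ε : ℤˣ)
    (hcert' : ∀ {N : ℕ} [NeZero N] (f : CuspForm (Gamma0 N) 2), IsNewformOf W' f →
      ∀ L : IwasawaAlgebra p, IsSignedPAdicLFunction f p ε L → mu L = 0 ∧ lam L = 1) :
    ∀ (κ : ZpExtension ℚ p) (γ : Field.absoluteGaloisGroup ℚ), κ.IsCyclotomic →
      κ.IsTopGenerator γ → IsCyclotomicVariable p γ → ∀ (D' : SignedSelmerDualData W' κ γ ε)
      [Module.Finite (IwasawaAlgebra p) D'.X], Module.IsTorsion (IwasawaAlgebra p) D'.X →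
      lambdaInvariant p D'.X = 1 := by
  intro κ γ hκ hγ hγ' D' _ hX'
  haveI : NeZero (W'.conductorNorm ℤ) := ⟨(W'.conductorNorm_pos_holds).ne'⟩
  obtain ⟨Dm⟩ := hmod W'
  set f := Dm.f with hf_def
  have hf : IsNewformOf W' f := Dm.isNewformOf
  obtain ⟨Lplus, Lminus, hPP⟩ := exists_isPollackPair hPollack hp hf hgood' hap'
  set L := kobayashiL ε Lplus Lminus with hL_def
  have hL : IsSignedPAdicLFunction f p ε L := hPP.isSignedPAdicLFunction_kobayashiL ε
  obtain ⟨ξ, hξ⟩ := (charIdeal_isPrincipal_holds p D'.X).principal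
  have hξ' : D'.charIdeal = Ideal.span {ξ} := hξ
  have hsurj : ∀ m : ℕ, W'.HasSurjectiveModNGaloisRep (p ^ m : ℕ) :=
    surjective_pow_of_surj_of_good W' p hL20 hp hgood' hs'
  have hU : ξ ∣ L := h41.dvd_of_charIdeal_eq_span hp hgood' hap' hf hκ hγ hγ' hL D' hX' hsurj hξ'
  -- (C): `T^{rank} ∣ ξ`, rank `= 1` by GZK
  have hC := D'.X_pow_mordellWeilRank_dvd_of_charIdeal_eq_span hγ hX' hξ'
  have hrank : W'.mordellWeilRank = 1 := (hGZK W' (by omega)).1.trans h1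
  rw [hrank] at hC
  obtain ⟨hμ, hlam⟩ := hcert' f hf L hL
  have hL0 : L ≠ 0 := ne_zero_of_lam_ne_zero (by rw [hlam]; exact one_ne_zero)
  obtain ⟨h, hfac⟩ := hU
  have hξ0 : ξ ≠ 0 := by
    rintro rfl
    exact hL0 (by rw [hfac, zero_mul])
  have hh0 : h ≠ 0 := by
    rintro rfl
    exact hL0 (by rw [hfac, mul_zero])
  have hge : 1 ≤ lam ξ := Summit.BirchSwinnertonDyer.Rank1Residual.X2.le_lam_of_X_pow_dvd hξ0 hC
  have hle : lam ξ ≤ 1 := by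
    have := lam_le_lam_mul hξ0 hh0
    rw [← hfac, hlam] at this
    exact this
  rw [← Summit.BirchSwinnertonDyer.Rank1Residual.X1.ParitySqueeze.lam_generator_eq_lambdaInvariant D'.X hX' hξ0 hξ]
  omega

/-! ### §4 Consumers: the crux's conclusion at the pair, and `BSD(E,p)` in analytic rank one -/

/-- **Item 3's statement AT THE PAIR from the congruence road**: `∃ ε, KobayashiLowerDivisibility W p ε`.
PER PAIR; closes nothing. [cite: Kobayashi2003, Conjecture (p. 2) and Thm. 4.1 (p. 8)] [cite: BDKim2009, Cor. 2.13 (p. 187)] -/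
theorem exists_kobayashiLowerDivisibility_of_lambdaTransfer
    (h12 : Kobayashi2003.thm12_signedSelmerDual_finite_torsion)
    (h41 : Kobayashi2003.thm41_signedCharIdeal_divisibility)
    (h5 : realPeriodRat_eq_unit_mul_plusPeriod) (h3 : realPeriodRat_eq_unit_mul_plusPeriod_three)
    (hL20 : Wuthrich2014.lemma20_surjective_threeAdic_of_semistable)
    (hKim : BDKim2009.cor213_signedLambda_add_sum_delta_eq_of_torsionIso)
    (hp : p ≠ 2) (hgood : W.HasGoodReductionAtPrime p) (hap : W.frobeniusTrace p = 0)
    (hs : Surj W p) (ε : ℤˣ) {l : ℕ}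
    (hcert : ∀ {N : ℕ} [NeZero N] (f : CuspForm (Gamma0 N) 2), IsNewformOf W f →
      ∀ L : IwasawaAlgebra p, IsSignedPAdicLFunction f p ε L → mu L = 0 ∧ lam L = l)
    {W' : WeierstrassCurve ℚ} [W'.IsElliptic] [W'.IsGloballyMinimal]
    (hgood' : W'.HasGoodReductionAtPrime p) (hap' : W'.frobeniusTrace p = 0)
    (he : ∃ e : geomTorsion W (p : ℤ) ≃+ geomTorsion W' (p : ℤ),
      ∀ (σ : Field.absoluteGaloisGroup ℚ) (P : geomTorsion W (p : ℤ)), e (σ • P) = σ • e P)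
    {l' : ℕ}
    (hlam' : ∀ (κ : ZpExtension ℚ p) (γ : Field.absoluteGaloisGroup ℚ), κ.IsCyclotomic →
      κ.IsTopGenerator γ → IsCyclotomicVariable p γ → ∀ (D' : SignedSelmerDualData W' κ γ ε)
      [Module.Finite (IwasawaAlgebra p) D'.X], Module.IsTorsion (IwasawaAlgebra p) D'.X →
      lambdaInvariant p D'.X = l')
    (S₀ : Finset (HeightOneSpectrum (𝓞 ℚ))) (hS₀ : ∀ v ∈ S₀, ((p : ℕ) : 𝓞 ℚ) ∉ v.asIdeal)
    (hS₀W : ∀ v : HeightOneSpectrum (𝓞 ℚ), ¬ W.HasGoodReductionAt v → v ∈ S₀)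
    (hS₀W' : ∀ v : HeightOneSpectrum (𝓞 ℚ), ¬ W'.HasGoodReductionAt v → v ∈ S₀)
    (hδ : l + ∑ v ∈ S₀, delta W p v = l' + ∑ v ∈ S₀, delta W' p v) :
    ∃ ε : ℤˣ, KobayashiLowerDivisibility W p ε :=
  ⟨ε, kobayashiLowerDivisibility_of_mainConjecture
    (kobayashiMainConjecture_of_lambdaTransfer h12 h41 h5 h3 hL20 hKim hp hgood hap hs ε hcert hgood'
      hap' he hlam' S₀ hS₀ hS₀W hS₀W' hδ)⟩

/-- **X7 ∩ {r_an = 1} ∩ {surj}: `BSD(E,p)` from the congruence road**, through the tree's rank-one ± road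
`X7.bsdp_of_kobayashiMainConjecture_of_corA5_of_analyticRank_eq_one` (BKO 2024 Cor. A.5 `hA5` with its
two displayed referee flags; `hmodr`; `hGZK`). PER PAIR; closes nothing. [cite: BurungaleKobayashiOta2023, App. A Cor. A.5]
[cite: Kobayashi2003, Thm. 7.4 (p. 13) and Conjecture (p. 2)] [cite: BDKim2009, Cor. 2.13 (p. 187)] -/
theorem X7RankOne.bsdp_of_lambdaTransfer
    (h12 : Kobayashi2003.thm12_signedSelmerDual_finite_torsion)
    (h41 : Kobayashi2003.thm41_signedCharIdeal_divisibility)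
    (h5 : realPeriodRat_eq_unit_mul_plusPeriod) (h3 : realPeriodRat_eq_unit_mul_plusPeriod_three)
    (hL20 : Wuthrich2014.lemma20_surjective_threeAdic_of_semistable)
    (hKim : BDKim2009.cor213_signedLambda_add_sum_delta_eq_of_torsionIso)
    (hA5 : corA5_pPart_of_signedCharIdeal_eq) (hmodr : hasEntireLFunction_rat)
    (hGZK : rank_eq_analyticRank_of_analyticRank_le_one)
    (hp : p ≠ 2) (hX : ClassX7 W p) (hap : W.frobeniusTrace p = 0) (hs : Surj W p)
    (h1 : W.analyticRank = 1) (ε : ℤˣ) {l : ℕ}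
    (hcert : ∀ {N : ℕ} [NeZero N] (f : CuspForm (Gamma0 N) 2), IsNewformOf W f →
      ∀ L : IwasawaAlgebra p, IsSignedPAdicLFunction f p ε L → mu L = 0 ∧ lam L = l)
    {W' : WeierstrassCurve ℚ} [W'.IsElliptic] [W'.IsGloballyMinimal]
    (hgood' : W'.HasGoodReductionAtPrime p) (hap' : W'.frobeniusTrace p = 0)
    (he : ∃ e : geomTorsion W (p : ℤ) ≃+ geomTorsion W' (p : ℤ),
      ∀ (σ : Field.absoluteGaloisGroup ℚ) (P : geomTorsion W (p : ℤ)), e (σ • P) = σ • e P)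
    {l' : ℕ}
    (hlam' : ∀ (κ : ZpExtension ℚ p) (γ : Field.absoluteGaloisGroup ℚ), κ.IsCyclotomic →
      κ.IsTopGenerator γ → IsCyclotomicVariable p γ → ∀ (D' : SignedSelmerDualData W' κ γ ε)
      [Module.Finite (IwasawaAlgebra p) D'.X], Module.IsTorsion (IwasawaAlgebra p) D'.X →
      lambdaInvariant p D'.X = l')
    (S₀ : Finset (HeightOneSpectrum (𝓞 ℚ))) (hS₀ : ∀ v ∈ S₀, ((p : ℕ) : 𝓞 ℚ) ∉ v.asIdeal)
    (hS₀W : ∀ v : HeightOneSpectrum (𝓞 ℚ), ¬ W.HasGoodReductionAt v → v ∈ S₀)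
    (hS₀W' : ∀ v : HeightOneSpectrum (𝓞 ℚ), ¬ W'.HasGoodReductionAt v → v ∈ S₀)
    (hδ : l + ∑ v ∈ S₀, delta W p v = l' + ∑ v ∈ S₀, delta W' p v) : BSDp W p :=
  X7.bsdp_of_kobayashiMainConjecture_of_corA5_of_analyticRank_eq_one W p hA5 hmodr hGZK hp hX hap h1 ε
    (kobayashiMainConjecture_of_lambdaTransfer h12 h41 h5 h3 hL20 hKim hp hX.1.1 hap hs ε hcert hgood'
      hap' he hlam' S₀ hS₀ hS₀W hS₀W' hδ)

end Summit.BirchSwinnertonDyer.BirchSwinnertonDyer.Theorems.CongruenceRoad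

end
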